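import Mathlib
import Literature.Computability.AlgebraicComplexity.NewtonPolygonTauBounds

/-!
# Crux `NewtonTauWeak` (stmt-ValiantsHypothesis-5904), line `slope-ladder`: the block-convexity FLOOR `M_r(N) = O(N^{2r/3})`

STUB 1 of `Cruxes/NewtonTauWeak/Lines/slope_ladder.lean` (`stub_blockConvexBound`) asks for a block count `r ≥ 2` and
`δ > 0` with `#S ≤ C (N+2)^{(2/3-δ) r}` for convexly independent `S ⊆ P_1 + ⋯ + P_r`, `#P_i ≤ N`.  This file records,
in the stub's own normal form, the bound it has to beat: the `δ = 0` statement holds for EVERY `r ≥ 2` with `C = 48`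
(`blockConvex_upper`), by the Eisenbrand–Pach–Rothvoß–Sopher theorem (in tree:
`KPTT.EPRS.card_le_of_convexIndependent_subset_add`, constant 16) applied to the split
`(P_1 + ⋯ + P_a) + (P_{a+1} + ⋯ + P_r)`, `a = ⌈r/2⌉`: `16 (N^{2a/3} N^{2(r-a)/3} + N^a + N^{r-a}) ≤ 48 (N+2)^{2r/3}`
because `3a ≤ 2r` and `3(r-a) ≤ 2r` for `r ≥ 2`.  Together with `…BlockConvexLagrange` (`M_{2k-1}(N) ≥ c N^k`) the kernel
now holds `c_r N^{⌈r/2⌉} ≤ M_r(N) ≤ 48 (N+2)^{2r/3}` for all `r ≥ 2`, tight at `r = 3`; the stub is the question whether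
the upper exponent drops for some `r ≥ 4`.  Helper (`--supports`); nothing here bears on `NewtonTauWeak` or `VP ≠ VNP`.
-/

set_option linter.dupNamespace false

namespace Summit.ValiantsHypothesis.ValiantsHypothesis.Theorems.NewtonFramesNewtonTauWeak.BlockConvexUpper

open scoped BigOperators Pointwise
open Literature.Computability.AlgebraicComplexity.KPTT.EPRS (card_le_of_convexIndependent_subset_add)

noncomputable section

/-- `#(Σ_{i∈s} P_i) ≤ Π_{i∈s} #P_i` for pointwise finset sums. [folklore] -/
theorem card_sum_le_prod {ι α : Type*} [AddCommMonoid α] [DecidableEq α] (s : Finset ι) (P : ι → Finset α) :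
    (∑ i ∈ s, P i).card ≤ ∏ i ∈ s, (P i).card := by
  classical
  induction s using Finset.induction_on with
  | empty => simp
  | insert a s ha ih =>
    rw [Finset.sum_insert ha, Finset.prod_insert ha]
    exact Finset.card_add_le.trans (Nat.mul_le_mul_left _ ih)

/-- `#(Σ_{i∈s} P_i) ≤ N^{#s}` when every `#P_i ≤ N`. [folklore] -/
theorem card_sum_le_pow {ι α : Type*} [AddCommMonoid α] [DecidableEq α] (s : Finset ι) (P : ι → Finset α)
    (N : ℕ) (hP : ∀ i ∈ s, (P i).card ≤ N) : (∑ i ∈ s, P i).card ≤ N ^ s.card := by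
  refine (card_sum_le_prod s P).trans ?_
  calc ∏ i ∈ s, (P i).card ≤ ∏ _i ∈ s, N := Finset.prod_le_prod' hP
    _ = N ^ s.card := Finset.prod_const N

/-- Real bookkeeping: `N^a ≤ (N+2)^{(2/3) r}` when `3a ≤ 2r`. [folklore] -/
theorem pow_le_rpow_of (N a r : ℕ) (h : 3 * a ≤ 2 * r) :
    ((N : ℝ) ^ a : ℝ) ≤ ((N : ℝ) + 2) ^ ((2 : ℝ) / 3 * (r : ℝ)) := by
  have hM : (1 : ℝ) ≤ (N : ℝ) + 2 := by have := (Nat.cast_nonneg N : (0 : ℝ) ≤ N); linarith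
  calc ((N : ℝ) ^ a : ℝ) ≤ ((N : ℝ) + 2) ^ a := by gcongr; linarith
    _ = ((N : ℝ) + 2) ^ ((a : ℕ) : ℝ) := (Real.rpow_natCast _ a).symm
    _ ≤ ((N : ℝ) + 2) ^ ((2 : ℝ) / 3 * (r : ℝ)) := by
        refine Real.rpow_le_rpow_of_exponent_le hM ?_
        have : (3 : ℝ) * a ≤ 2 * r := by exact_mod_cast h
        linarith

/-- **The floor of block convexity: `M_r(N) ≤ 48 (N+2)^{2r/3}` for every `r ≥ 2`** (the `δ = 0` case of
`stub_blockConvexBound`, all `r` at once), from the Eisenbrand–Pach–Rothvoß–Sopher bound for the split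
`(P_1+⋯+P_a) + (P_{a+1}+⋯+P_r)`, `a = ⌈r/2⌉`. [EisenbrandEtAl2008 Thm 1; KoiranPortierTavenasThomasse2015 §4] -/
theorem blockConvex_upper (r : ℕ) (hr : 2 ≤ r) (N : ℕ) (P : Fin r → Finset (Fin 2 → ℝ)) (S : Finset (Fin 2 → ℝ))
    (hP : ∀ i, (P i).card ≤ N) (hS : S ⊆ ∑ i, P i)
    (hci : ConvexIndependent ℝ (Subtype.val : ↥(S : Set (Fin 2 → ℝ)) → (Fin 2 → ℝ))) :
    (S.card : ℝ) ≤ 48 * ((N : ℝ) + 2) ^ ((2 : ℝ) / 3 * (r : ℝ)) := by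
  classical
  -- choose the first block of `a = ⌈r/2⌉` summands
  set a : ℕ := (r + 1) / 2 with ha
  have har : a ≤ (Finset.univ : Finset (Fin r)).card := by rw [Finset.card_univ, Fintype.card_fin]; omega
  obtain ⟨A, hAsub, hAcard⟩ := Finset.exists_subset_card_eq har
  set B : Finset (Fin r) := Finset.univ \ A with hB
  have hBcard : B.card = r - a := by
    rw [hB, Finset.card_sdiff_of_subset hAsub, Finset.card_univ, Fintype.card_fin, hAcard]
  have h3a : 3 * a ≤ 2 * r := by omega
  have h3b : 3 * (r - a) ≤ 2 * r := by omega
  -- the split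
  set X : Finset (Fin 2 → ℝ) := ∑ i ∈ A, P i with hX
  set Y : Finset (Fin 2 → ℝ) := ∑ i ∈ B, P i with hY
  have hsplit : ∑ i, P i = X + Y := by
    rw [hX, hY, hB, add_comm, Finset.sum_sdiff hAsub]
  have hSXY : S ⊆ X + Y := hsplit ▸ hS
  have hXc : X.card ≤ N ^ a := hAcard ▸ card_sum_le_pow A P N fun i _ => hP i
  have hYc : Y.card ≤ N ^ (r - a) := hBcard ▸ card_sum_le_pow B P N fun i _ => hP i
  -- EPRS
  have hE := card_le_of_convexIndependent_subset_add X Y S hSXY hci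
  -- real bookkeeping
  set M : ℝ := (N : ℝ) + 2 with hM
  have hM0 : (0 : ℝ) ≤ M := by rw [hM]; positivity
  have hXr : (X.card : ℝ) ≤ (N : ℝ) ^ a := by exact_mod_cast hXc
  have hYr : (Y.card : ℝ) ≤ (N : ℝ) ^ (r - a) := by exact_mod_cast hYc
  have hXM : (X.card : ℝ) ≤ M ^ ((2 : ℝ) / 3 * (r : ℝ)) := hXr.trans (pow_le_rpow_of N a r h3a)
  have hYM : (Y.card : ℝ) ≤ M ^ ((2 : ℝ) / 3 * (r : ℝ)) := hYr.trans (pow_le_rpow_of N (r - a) r h3b)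
  -- the product term: #X^{2/3} #Y^{2/3} ≤ (M^a)^{2/3} (M^{r-a})^{2/3} = M^{2r/3}
  have hX0 : (0 : ℝ) ≤ X.card := Nat.cast_nonneg _
  have hY0 : (0 : ℝ) ≤ Y.card := Nat.cast_nonneg _
  have hNM : (N : ℝ) ≤ M := by rw [hM]; linarith
  have hN0 : (0 : ℝ) ≤ N := Nat.cast_nonneg _
  have hXa : (X.card : ℝ) ^ ((2 : ℝ) / 3) ≤ M ^ ((a : ℝ) * (2 / 3)) := by
    calc (X.card : ℝ) ^ ((2 : ℝ) / 3) ≤ ((N : ℝ) ^ a) ^ ((2 : ℝ) / 3) :=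
          Real.rpow_le_rpow hX0 hXr (by norm_num)
      _ ≤ (M ^ a) ^ ((2 : ℝ) / 3) := by
          refine Real.rpow_le_rpow (by positivity) ?_ (by norm_num)
          gcongr
      _ = M ^ ((a : ℝ) * (2 / 3)) := by rw [← Real.rpow_natCast M a, ← Real.rpow_mul hM0]
  have hYb : (Y.card : ℝ) ^ ((2 : ℝ) / 3) ≤ M ^ (((r - a : ℕ) : ℝ) * (2 / 3)) := by
    calc (Y.card : ℝ) ^ ((2 : ℝ) / 3) ≤ ((N : ℝ) ^ (r - a)) ^ ((2 : ℝ) / 3) :=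
          Real.rpow_le_rpow hY0 hYr (by norm_num)
      _ ≤ (M ^ (r - a)) ^ ((2 : ℝ) / 3) := by
          refine Real.rpow_le_rpow (by positivity) ?_ (by norm_num)
          gcongr
      _ = M ^ (((r - a : ℕ) : ℝ) * (2 / 3)) := by rw [← Real.rpow_natCast M (r - a), ← Real.rpow_mul hM0]
  have hprod : (X.card : ℝ) ^ ((2 : ℝ) / 3) * (Y.card : ℝ) ^ ((2 : ℝ) / 3) ≤ M ^ ((2 : ℝ) / 3 * (r : ℝ)) := by
    have har' : a ≤ r := by omega
    have hsum : (a : ℝ) * (2 / 3) + ((r - a : ℕ) : ℝ) * (2 / 3) = (2 : ℝ) / 3 * (r : ℝ) := by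
      rw [Nat.cast_sub har']; ring
    have hM1 : (0 : ℝ) < M := by rw [hM]; positivity
    calc (X.card : ℝ) ^ ((2 : ℝ) / 3) * (Y.card : ℝ) ^ ((2 : ℝ) / 3)
        ≤ M ^ ((a : ℝ) * (2 / 3)) * M ^ (((r - a : ℕ) : ℝ) * (2 / 3)) :=
          mul_le_mul hXa hYb (by positivity) (by positivity)
      _ = M ^ ((2 : ℝ) / 3 * (r : ℝ)) := by rw [← Real.rpow_add hM1, hsum]
  calc (S.card : ℝ) ≤ 16 * ((X.card : ℝ) ^ ((2 : ℝ) / 3) * (Y.card : ℝ) ^ ((2 : ℝ) / 3) + X.card + Y.card) := hE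
    _ ≤ 16 * (M ^ ((2 : ℝ) / 3 * (r : ℝ)) + M ^ ((2 : ℝ) / 3 * (r : ℝ)) + M ^ ((2 : ℝ) / 3 * (r : ℝ))) := by
        gcongr
    _ = 48 * M ^ ((2 : ℝ) / 3 * (r : ℝ)) := by ring

/-- The floor in the stub's literal shape with `δ = 0`: for every `r ≥ 2` the block bound with exponent `(2/3 - 0) r`
holds with `C = 48` (so `stub_blockConvexBound` is exactly the question of a POSITIVE `δ` at some `r`). [this file] -/
theorem blockConvexBound_delta_zero (r : ℕ) (hr : 2 ≤ r) :
    ∀ (N : ℕ) (P : Fin r → Finset (Fin 2 → ℝ)) (S : Finset (Fin 2 → ℝ)),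
      (∀ i, (P i).card ≤ N) → S ⊆ ∑ i, P i →
        ConvexIndependent ℝ (Subtype.val : ↥(S : Set (Fin 2 → ℝ)) → (Fin 2 → ℝ)) →
          (S.card : ℝ) ≤ 48 * ((N : ℝ) + 2) ^ ((2 / 3 - 0) * (r : ℝ)) := by
  intro N P S hP hS hci
  rw [sub_zero]
  exact blockConvex_upper r hr N P S hP hS hci

end

end Summit.ValiantsHypothesis.ValiantsHypothesis.Theorems.NewtonFramesNewtonTauWeak.BlockConvexUpper
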